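import Summits.CriticalPhenomena.PercolationContinuityZ3.Theorems.PercNearOneGluingAdditiveGluingQ9Line
import Summits.CriticalPhenomena.PercolationContinuityZ3.Theorems.PercNearOneGluingNoHeavyLowerTailTypedReductions
import Summits.CriticalPhenomena.PercolationContinuityZ3.Theses.PercNearOneGluingNoHeavy
import HarnessLib

/-!
# `NoHeavyLowerTail` (stmt-CriticalPhenomena-4575) and `AdditiveGluing` (stmt-CriticalPhenomena-4576):
# both cruxes reduced to ONE merge law for Kozma–Nitzan block goodness (route task `nh-dp-commonrelay`, gen 1)

Support file (`--supports stmt-CriticalPhenomena-4575`).  No definitions, no named facts.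

The residual kernel `hres9` of the Q9 line (`additiveGluing_of_residualKernelQ9`,
`…AdditiveGluingQ9Line`) asks for Kozma–Nitzan block goodness (arXiv:2401.12397, §3.2, Definition p. 12 with
selection pockets) of a BAD glued block `S` (`2 ≤ |S|`) against the un-glued worst relay `a₀`, under drift, for
`4 ≤ |A|`, given the Q9 induction hypothesis `IH9`.  This file shows that the kernel follows from the
**merge step**: block goodness (for every selection) of `S` and of a single further bad vertex `y` — the least
`a₀`-attached one — implies block goodness of `insert y S` (same graph, same `a₀`, drift of the merged block and
`IH9` available as hypotheses).  Singletons are good for free (`IH9` at the un-glued graph + monotonicity of the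
designated inequality in the relay, via `blockKernel_of_designated`), drift-free sub-blocks are good by
`blockGood_leaf_ih`, so an induction on `|S|` peeling the least-attached vertex gives the kernel:

* `residualKernelQ9_of_mergeStep` : merge step ⇒ `hres9` (statement verbatim);
* `additiveGluing_of_mergeStep`   : merge step ⇒ `AdditiveGluing` (by `additiveGluing_of_residualKernelQ9`);
* `noHeavyLowerTail_of_mergeStep` : merge step ⇒ `NoHeavyLowerTail` (landed chain AG ⇒ NearOneGluing ⇒ residual ⇒ crux).

Why the merge step is the right residual (paper identity, this seat; numerics 0 violations, see item evidence
MERGE-LAW.md): with `G_S := μ(S~b,S≁a₀) − μ(a₀~b,S≁a₀) + Σ_{W dead} μ(K_S=W)·min_a μ_{K∖W}(a~b)` (= slack of block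
goodness at the min selection), `G_{S∪y} = G_S − μ(S:b, y~a₀) + μ(S:A, y~b) + I` with `I ≥ 0` under `IH9`;
the only loss term is `μ(S:b, y~a₀)`.
[cite: KozmaNitzan2024, §3.2 (Definition p. 12, Lemma 5 p. 13, Thms 4–5 pp. 12–14), Question 9 (p. 36)]
-/

namespace Summit.CriticalPhenomena.PercolationContinuityZ3.Theorems

open MeasureTheory Set
open Literature.Probability.LatticeModels (prodBernoulli)
open Literature.Probability.Percolation (BondConfig openConn openConnIn openGraph openCluster)
open scoped BigOperators

noncomputable section
open Classical

section MergeStep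
open Literature.Probability.LatticeModels Literature.Probability.Percolation

variable {n : ℕ}

/-- Gluing a larger block can only create more positive-degree vertices. [folklore] -/
theorem mergeStep_card_glue_mono (u : Sym2 (Fin n) → unitInterval) (S' S : Finset (Fin n)) (hS : S' ⊆ S) :
    (Finset.univ.filter (fun v : Fin n => ∃ z : Fin n,
        0 < ((fun e : Sym2 (Fin n) => if (∀ x ∈ e, x ∈ S') ∧ ¬ e.IsDiag then 1 else u e) s(z, v) : ℝ))).card ≤
      (Finset.univ.filter (fun v : Fin n => ∃ z : Fin n,
        0 < ((fun e : Sym2 (Fin n) => if (∀ x ∈ e, x ∈ S) ∧ ¬ e.IsDiag then 1 else u e) s(z, v) : ℝ))).card := by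
  refine Finset.card_le_card fun v hv => ?_
  simp only [Finset.mem_filter, Finset.mem_univ, true_and] at hv ⊢
  obtain ⟨z, hz⟩ := hv
  refine ⟨z, ?_⟩
  by_cases h1 : (∀ x ∈ s(z, v), x ∈ S') ∧ ¬ (s(z, v)).IsDiag
  · have h2 : (∀ x ∈ s(z, v), x ∈ S) ∧ ¬ (s(z, v)).IsDiag := ⟨fun x hx => hS (h1.1 x hx), h1.2⟩
    rw [if_pos h2]
    norm_num
  · rw [if_neg h1] at hz
    by_cases h2 : (∀ x ∈ s(z, v), x ∈ S) ∧ ¬ (s(z, v)).IsDiag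
    · rw [if_pos h2]; norm_num
    · rw [if_neg h2]; exact hz

/-- Gluing a block can only create more positive-degree vertices (un-glued versus glued). [folklore] -/
theorem mergeStep_card_le_glue (u : Sym2 (Fin n) → unitInterval) (S : Finset (Fin n)) :
    (Finset.univ.filter (fun v : Fin n => ∃ z : Fin n, 0 < (u s(z, v) : ℝ))).card ≤
      (Finset.univ.filter (fun v : Fin n => ∃ z : Fin n,
        0 < ((fun e : Sym2 (Fin n) => if (∀ x ∈ e, x ∈ S) ∧ ¬ e.IsDiag then 1 else u e) s(z, v) : ℝ))).card := by
  refine Finset.card_le_card fun v hv => ?_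
  simp only [Finset.mem_filter, Finset.mem_univ, true_and] at hv ⊢
  obtain ⟨z, hz⟩ := hv
  refine ⟨z, ?_⟩
  by_cases h2 : (∀ x ∈ s(z, v), x ∈ S) ∧ ¬ (s(z, v)).IsDiag
  · rw [if_pos h2]; norm_num
  · rw [if_neg h2]; exact hz

/-- **Merge step ⇒ the residual kernel `hres9` of the Q9 line** (statement of the kernel verbatim as in
`additiveGluing_of_residualKernelQ9`).  Induction on the size of the sub-block, peeling its least `a₀`-attached vertex;
singletons by `IH9` + `blockKernel_of_designated`, drift-free sub-blocks by `blockGood_leaf_ih`, the rest by the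
merge step. [cite: KozmaNitzan2024, §3.2 (Definition p. 12, Thms 4–5 pp. 12–14)] -/
theorem residualKernelQ9_of_mergeStep
    (hM : (∀ (n : ℕ) (u : Sym2 (Fin n) → unitInterval) (A S : Finset (Fin n)) (b a₀ y : Fin n),
      b ∈ A → Disjoint S A → y ∉ A → y ∉ S → S.Nonempty → 4 ≤ A.card → a₀ ∈ A →
      (∀ a ∈ A, (prodBernoulli u).real (openConn a₀ b) ≤ (prodBernoulli u).real (openConn a b)) →
      (∀ v ∈ insert y S, (prodBernoulli u).real (openConn v b) < (prodBernoulli u).real (openConn a₀ b)) →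
      (∀ s ∈ S, (prodBernoulli u).real (openConn y a₀) ≤ (prodBernoulli u).real (openConn s a₀)) →
      (∃ a ∈ A, (prodBernoulli (fun e : Sym2 (Fin n) => if (∀ x ∈ e, x ∈ insert y S) ∧ ¬ e.IsDiag then 1 else u e)).real (openConn a b) <
        (prodBernoulli (fun e : Sym2 (Fin n) => if (∀ x ∈ e, x ∈ insert y S) ∧ ¬ e.IsDiag then 1 else u e)).real (openConn a₀ b)) →
      (∀ w' : Sym2 (Fin n) → unitInterval,
        (Finset.univ.filter (fun v : Fin n => ∃ z : Fin n, 0 < (w' s(z, v) : ℝ))).card ≤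
          (Finset.univ.filter (fun v : Fin n => ∃ z : Fin n,
            0 < ((fun e : Sym2 (Fin n) => if (∀ x ∈ e, x ∈ insert y S) ∧ ¬ e.IsDiag then 1 else u e) s(z, v) : ℝ))).card →
        ∀ (A' : Finset (Fin n)) (o' b' : Fin n), b' ∈ A' → o' ∉ A' →
        ∀ c₀ : Fin n, c₀ ∈ A' →
          (∀ c ∈ A', (prodBernoulli (fun e : Sym2 (Fin n) => if o' ∈ e then (0 : unitInterval) else w' e)).real (openConn c₀ b') ≤
            (prodBernoulli (fun e : Sym2 (Fin n) => if o' ∈ e then (0 : unitInterval) else w' e)).real (openConn c b')) →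
          ∀ sel' : Finset (Fin n) → Fin n, (∀ W', sel' W' ∈ A') →
          (prodBernoulli w').real (openConn c₀ b') ≤
            (prodBernoulli w').real (openConn o' b')
              + ∑ W' ∈ (Finset.univ : Finset (Finset (Fin n))).filter (fun W' => o' ∈ W' ∧ Disjoint W' A'),
                  (prodBernoulli w').real {ω : BondConfig (Fin n) | openCluster ω o' = (W' : Set (Fin n))}
                    * (prodBernoulli w').real (openConnIn ((W' : Set (Fin n))ᶜ) (sel' W') b')) →
      (∀ sel : Finset (Fin n) → Fin n, (∀ W, sel W ∈ A) →
        ((prodBernoulli u).real (openConn a₀ b)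
          + (prodBernoulli u).real ((openConn a₀ b)ᶜ ∩ (⋃ s ∈ S, openConn a₀ s) ∩ (⋃ s ∈ S, openConn s b))
        ≤ (prodBernoulli u).real (⋃ s ∈ S, openConn s b)
          + ∑ W ∈ (Finset.univ : Finset (Finset (Fin n))).filter (fun W => Disjoint W A),
              (prodBernoulli u).real {ω : BondConfig (Fin n) | ∀ z : Fin n, (z ∈ W ↔ ω ∈ ⋃ s ∈ S, openConn s z)}
                * (prodBernoulli u).real (openConnIn ((W : Set (Fin n))ᶜ) (sel W) b))) →
      (∀ sel : Finset (Fin n) → Fin n, (∀ W, sel W ∈ A) →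
        ((prodBernoulli u).real (openConn a₀ b)
          + (prodBernoulli u).real ((openConn a₀ b)ᶜ ∩ (⋃ s ∈ ({y} : Finset (Fin n)), openConn a₀ s) ∩ (⋃ s ∈ ({y} : Finset (Fin n)), openConn s b))
        ≤ (prodBernoulli u).real (⋃ s ∈ ({y} : Finset (Fin n)), openConn s b)
          + ∑ W ∈ (Finset.univ : Finset (Finset (Fin n))).filter (fun W => Disjoint W A),
              (prodBernoulli u).real {ω : BondConfig (Fin n) | ∀ z : Fin n, (z ∈ W ↔ ω ∈ ⋃ s ∈ ({y} : Finset (Fin n)), openConn s z)}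
                * (prodBernoulli u).real (openConnIn ((W : Set (Fin n))ᶜ) (sel W) b))) →
      ∀ sel : Finset (Fin n) → Fin n, (∀ W, sel W ∈ A) →
        ((prodBernoulli u).real (openConn a₀ b)
          + (prodBernoulli u).real ((openConn a₀ b)ᶜ ∩ (⋃ s ∈ insert y S, openConn a₀ s) ∩ (⋃ s ∈ insert y S, openConn s b))
        ≤ (prodBernoulli u).real (⋃ s ∈ insert y S, openConn s b)
          + ∑ W ∈ (Finset.univ : Finset (Finset (Fin n))).filter (fun W => Disjoint W A),
              (prodBernoulli u).real {ω : BondConfig (Fin n) | ∀ z : Fin n, (z ∈ W ↔ ω ∈ ⋃ s ∈ insert y S, openConn s z)}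
                * (prodBernoulli u).real (openConnIn ((W : Set (Fin n))ᶜ) (sel W) b)))) :
    (∀ (n : ℕ) (u : Sym2 (Fin n) → unitInterval) (A S : Finset (Fin n)) (b a₀ : Fin n)
      (sel : Finset (Fin n) → Fin n),
      b ∈ A → Disjoint S A → 2 ≤ S.card → 4 ≤ A.card → (∀ W, sel W ∈ A) → a₀ ∈ A →
      (∀ a ∈ A, (prodBernoulli u).real (openConn a₀ b) ≤ (prodBernoulli u).real (openConn a b)) →
      (∀ v ∈ S, (prodBernoulli u).real (openConn v b) < (prodBernoulli u).real (openConn a₀ b)) →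
      (∃ a ∈ A, (prodBernoulli (fun e : Sym2 (Fin n) => if (∀ x ∈ e, x ∈ S) ∧ ¬ e.IsDiag then 1 else u e)).real (openConn a b) <
        (prodBernoulli (fun e : Sym2 (Fin n) => if (∀ x ∈ e, x ∈ S) ∧ ¬ e.IsDiag then 1 else u e)).real (openConn a₀ b)) →
      (∀ w' : Sym2 (Fin n) → unitInterval,
        (Finset.univ.filter (fun v : Fin n => ∃ z : Fin n, 0 < (w' s(z, v) : ℝ))).card ≤
          (Finset.univ.filter (fun v : Fin n => ∃ z : Fin n,
            0 < ((fun e : Sym2 (Fin n) => if (∀ x ∈ e, x ∈ S) ∧ ¬ e.IsDiag then 1 else u e) s(z, v) : ℝ))).card →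
        ∀ (A' : Finset (Fin n)) (o' b' : Fin n), b' ∈ A' → o' ∉ A' →
        ∀ c₀ : Fin n, c₀ ∈ A' →
          (∀ c ∈ A', (prodBernoulli (fun e : Sym2 (Fin n) => if o' ∈ e then (0 : unitInterval) else w' e)).real (openConn c₀ b') ≤
            (prodBernoulli (fun e : Sym2 (Fin n) => if o' ∈ e then (0 : unitInterval) else w' e)).real (openConn c b')) →
          ∀ sel' : Finset (Fin n) → Fin n, (∀ W', sel' W' ∈ A') →
          (prodBernoulli w').real (openConn c₀ b') ≤
            (prodBernoulli w').real (openConn o' b')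
              + ∑ W' ∈ (Finset.univ : Finset (Finset (Fin n))).filter (fun W' => o' ∈ W' ∧ Disjoint W' A'),
                  (prodBernoulli w').real {ω : BondConfig (Fin n) | openCluster ω o' = (W' : Set (Fin n))}
                    * (prodBernoulli w').real (openConnIn ((W' : Set (Fin n))ᶜ) (sel' W') b')) →
      ((prodBernoulli u).real (openConn a₀ b)
          + (prodBernoulli u).real ((openConn a₀ b)ᶜ ∩ (⋃ s ∈ S, openConn a₀ s) ∩ (⋃ s ∈ S, openConn s b))
        ≤ (prodBernoulli u).real (⋃ s ∈ S, openConn s b)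
          + ∑ W ∈ (Finset.univ : Finset (Finset (Fin n))).filter (fun W => Disjoint W A),
              (prodBernoulli u).real {ω : BondConfig (Fin n) | ∀ z : Fin n, (z ∈ W ↔ ω ∈ ⋃ s ∈ S, openConn s z)}
                * (prodBernoulli u).real (openConnIn ((W : Set (Fin n))ᶜ) (sel W) b))) := by
  intro n u A S b a₀ sel hb hSA h2 hA4 hsel ha₀ hmin hbad hdrift IH9
  -- singletons: goodness of {y} for every y ∈ S and every selection
  have hsingle : ∀ y ∈ S, ∀ sel' : Finset (Fin n) → Fin n, (∀ W, sel' W ∈ A) →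
      ((prodBernoulli u).real (openConn a₀ b)
          + (prodBernoulli u).real ((openConn a₀ b)ᶜ ∩ (⋃ s ∈ ({y} : Finset (Fin n)), openConn a₀ s) ∩ (⋃ s ∈ ({y} : Finset (Fin n)), openConn s b))
        ≤ (prodBernoulli u).real (⋃ s ∈ ({y} : Finset (Fin n)), openConn s b)
          + ∑ W ∈ (Finset.univ : Finset (Finset (Fin n))).filter (fun W => Disjoint W A),
              (prodBernoulli u).real {ω : BondConfig (Fin n) | ∀ z : Fin n, (z ∈ W ↔ ω ∈ ⋃ s ∈ ({y} : Finset (Fin n)), openConn s z)}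
                * (prodBernoulli u).real (openConnIn ((W : Set (Fin n))ᶜ) (sel' W) b)) := by
    intro y hy sel' hsel'
    have hyA : y ∉ A := Finset.disjoint_left.1 hSA hy
    have hcard : (Finset.univ.filter (fun v : Fin n => ∃ z : Fin n, 0 < (u s(z, v) : ℝ))).card ≤
        (Finset.univ.filter (fun v : Fin n => ∃ z : Fin n,
          0 < ((fun e : Sym2 (Fin n) => if (∀ x ∈ e, x ∈ S) ∧ ¬ e.IsDiag then 1 else u e) s(z, v) : ℝ))).card := mergeStep_card_le_glue u S
    have hQ := IH9 u hcard A y b hb hyA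
    obtain ⟨a', ha', hmin'⟩ := Finset.exists_min_image A
      (fun a => (prodBernoulli (fun e : Sym2 (Fin n) => if y ∈ e then (0 : unitInterval) else u e)).real
        (openConn a b)) ⟨b, hb⟩
    have hdes := hQ a' ha' hmin' sel' hsel'
    refine blockKernel_of_designated u A {y} b a₀ a' y sel' (Finset.mem_singleton_self y) ?_ ?_
    · rw [goodStep24_glue_singleton u y]
      exact hmin a' ha'
    · rw [goodStep24_glue_singleton u y]
      exact hdes
  -- induction on the size of the sub-block
  have main : ∀ k : ℕ, ∀ S' : Finset (Fin n), S' ⊆ S → S'.card = k + 1 →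
      ∀ sel' : Finset (Fin n) → Fin n, (∀ W, sel' W ∈ A) →
      ((prodBernoulli u).real (openConn a₀ b)
          + (prodBernoulli u).real ((openConn a₀ b)ᶜ ∩ (⋃ s ∈ S', openConn a₀ s) ∩ (⋃ s ∈ S', openConn s b))
        ≤ (prodBernoulli u).real (⋃ s ∈ S', openConn s b)
          + ∑ W ∈ (Finset.univ : Finset (Finset (Fin n))).filter (fun W => Disjoint W A),
              (prodBernoulli u).real {ω : BondConfig (Fin n) | ∀ z : Fin n, (z ∈ W ↔ ω ∈ ⋃ s ∈ S', openConn s z)}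
                * (prodBernoulli u).real (openConnIn ((W : Set (Fin n))ᶜ) (sel' W) b)) := by
    intro k
    induction k with
    | zero =>
      intro S' hS'S hcard1 sel' hsel'
      obtain ⟨y, rfl⟩ := Finset.card_eq_one.1 hcard1
      exact hsingle y (hS'S (Finset.mem_singleton_self y)) sel' hsel'
    | succ k ih =>
      intro S' hS'S hcardS' sel' hsel'
      have hS'ne : S'.Nonempty := Finset.card_pos.1 (by omega)
      have hS'A : Disjoint S' A := Finset.disjoint_of_subset_left hS'S hSA
      have hcardG : (Finset.univ.filter (fun v : Fin n => ∃ z : Fin n,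
            0 < ((fun e : Sym2 (Fin n) => if (∀ x ∈ e, x ∈ S') ∧ ¬ e.IsDiag then 1 else u e) s(z, v) : ℝ))).card ≤
          (Finset.univ.filter (fun v : Fin n => ∃ z : Fin n,
            0 < ((fun e : Sym2 (Fin n) => if (∀ x ∈ e, x ∈ S) ∧ ¬ e.IsDiag then 1 else u e) s(z, v) : ℝ))).card := mergeStep_card_glue_mono u S' S hS'S
      by_cases hfree : ∀ a ∈ A, (prodBernoulli (fun e : Sym2 (Fin n) => if (∀ x ∈ e, x ∈ S') ∧ ¬ e.IsDiag then 1 else u e)).real (openConn a₀ b) ≤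
          (prodBernoulli (fun e : Sym2 (Fin n) => if (∀ x ∈ e, x ∈ S') ∧ ¬ e.IsDiag then 1 else u e)).real (openConn a b)
      · -- no drift: goodness of the glued quadruple from its Q9 goodness (IH9)
        obtain ⟨s₀, hs₀⟩ := hS'ne
        have hs₀A : s₀ ∉ A := Finset.disjoint_left.1 hS'A hs₀
        have hQg := IH9 (fun e : Sym2 (Fin n) => if (∀ x ∈ e, x ∈ S') ∧ ¬ e.IsDiag then 1 else u e) hcardG A s₀ b hb hs₀A
        exact blockGood_leaf_ih u A S' b a₀ s₀ sel' hs₀ hb hsel' hfree (good_of_q9 _ A s₀ b hb hQg)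
      · -- drift: peel the least a₀-attached vertex and merge
        push Not at hfree
        obtain ⟨y, hyS', hymin⟩ := Finset.exists_min_image S'
          (fun s => (prodBernoulli u).real (openConn s a₀)) hS'ne
        set S'' : Finset (Fin n) := S'.erase y with hS''def
        have hyS'' : y ∉ S'' := Finset.notMem_erase y S'
        have hins : insert y S'' = S' := Finset.insert_erase hyS'
        have hS''S : S'' ⊆ S := (Finset.erase_subset y S').trans hS'S
        have hS''card : S''.card = k + 1 := by
          rw [hS''def, Finset.card_erase_of_mem hyS']; omega
        have hS''ne : S''.Nonempty := Finset.card_pos.1 (by omega)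
        have hS''A : Disjoint S'' A := Finset.disjoint_of_subset_left hS''S hSA
        have hyA : y ∉ A := Finset.disjoint_left.1 hS'A hyS'
        have hgoodS'' : ∀ sel₂ : Finset (Fin n) → Fin n, (∀ W, sel₂ W ∈ A) →
            ((prodBernoulli u).real (openConn a₀ b)
          + (prodBernoulli u).real ((openConn a₀ b)ᶜ ∩ (⋃ s ∈ S'', openConn a₀ s) ∩ (⋃ s ∈ S'', openConn s b))
        ≤ (prodBernoulli u).real (⋃ s ∈ S'', openConn s b)
          + ∑ W ∈ (Finset.univ : Finset (Finset (Fin n))).filter (fun W => Disjoint W A),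
              (prodBernoulli u).real {ω : BondConfig (Fin n) | ∀ z : Fin n, (z ∈ W ↔ ω ∈ ⋃ s ∈ S'', openConn s z)}
                * (prodBernoulli u).real (openConnIn ((W : Set (Fin n))ᶜ) (sel₂ W) b)) := fun sel₂ hsel₂ => ih S'' hS''S hS''card sel₂ hsel₂
        have hgoody := hsingle y (hS'S hyS')
        rw [← hins]
        rw [← hins] at hfree hcardG
        refine hM n u A S'' b a₀ y hb hS''A hyA hyS'' hS''ne hA4 ha₀ hmin ?_ ?_ hfree ?_ hgoodS'' hgoody sel' hsel'
        · intro v hv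
          rw [hins] at hv
          exact hbad v (hS'S hv)
        · intro s hs
          exact hymin s (Finset.mem_of_mem_erase hs)
        · intro w' hw' A' o' b' hb' ho'
          exact IH9 w' (hw'.trans hcardG) A' o' b' hb' ho'
  have hcardS : S.card = (S.card - 1) + 1 := by omega
  exact main (S.card - 1) S (Finset.Subset.refl S) hcardS sel hsel

/-- **Merge step ⇒ `AdditiveGluing`** (crux stmt-CriticalPhenomena-4576), through `additiveGluing_of_residualKernelQ9`.
[cite: KozmaNitzan2024, §3.2 (Definition p. 12, Thms 4–5 pp. 12–14), Conjecture 1 (p. 3)] -/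
theorem additiveGluing_of_mergeStep :
    (∀ (n : ℕ) (u : Sym2 (Fin n) → unitInterval) (A S : Finset (Fin n)) (b a₀ y : Fin n),
      b ∈ A → Disjoint S A → y ∉ A → y ∉ S → S.Nonempty → 4 ≤ A.card → a₀ ∈ A →
      (∀ a ∈ A, (prodBernoulli u).real (openConn a₀ b) ≤ (prodBernoulli u).real (openConn a b)) →
      (∀ v ∈ insert y S, (prodBernoulli u).real (openConn v b) < (prodBernoulli u).real (openConn a₀ b)) →
      (∀ s ∈ S, (prodBernoulli u).real (openConn y a₀) ≤ (prodBernoulli u).real (openConn s a₀)) →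
      (∃ a ∈ A, (prodBernoulli (fun e : Sym2 (Fin n) => if (∀ x ∈ e, x ∈ insert y S) ∧ ¬ e.IsDiag then 1 else u e)).real (openConn a b) <
        (prodBernoulli (fun e : Sym2 (Fin n) => if (∀ x ∈ e, x ∈ insert y S) ∧ ¬ e.IsDiag then 1 else u e)).real (openConn a₀ b)) →
      (∀ w' : Sym2 (Fin n) → unitInterval,
        (Finset.univ.filter (fun v : Fin n => ∃ z : Fin n, 0 < (w' s(z, v) : ℝ))).card ≤
          (Finset.univ.filter (fun v : Fin n => ∃ z : Fin n,
            0 < ((fun e : Sym2 (Fin n) => if (∀ x ∈ e, x ∈ insert y S) ∧ ¬ e.IsDiag then 1 else u e) s(z, v) : ℝ))).card →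
        ∀ (A' : Finset (Fin n)) (o' b' : Fin n), b' ∈ A' → o' ∉ A' →
        ∀ c₀ : Fin n, c₀ ∈ A' →
          (∀ c ∈ A', (prodBernoulli (fun e : Sym2 (Fin n) => if o' ∈ e then (0 : unitInterval) else w' e)).real (openConn c₀ b') ≤
            (prodBernoulli (fun e : Sym2 (Fin n) => if o' ∈ e then (0 : unitInterval) else w' e)).real (openConn c b')) →
          ∀ sel' : Finset (Fin n) → Fin n, (∀ W', sel' W' ∈ A') →
          (prodBernoulli w').real (openConn c₀ b') ≤
            (prodBernoulli w').real (openConn o' b')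
              + ∑ W' ∈ (Finset.univ : Finset (Finset (Fin n))).filter (fun W' => o' ∈ W' ∧ Disjoint W' A'),
                  (prodBernoulli w').real {ω : BondConfig (Fin n) | openCluster ω o' = (W' : Set (Fin n))}
                    * (prodBernoulli w').real (openConnIn ((W' : Set (Fin n))ᶜ) (sel' W') b')) →
      (∀ sel : Finset (Fin n) → Fin n, (∀ W, sel W ∈ A) →
        ((prodBernoulli u).real (openConn a₀ b)
          + (prodBernoulli u).real ((openConn a₀ b)ᶜ ∩ (⋃ s ∈ S, openConn a₀ s) ∩ (⋃ s ∈ S, openConn s b))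
        ≤ (prodBernoulli u).real (⋃ s ∈ S, openConn s b)
          + ∑ W ∈ (Finset.univ : Finset (Finset (Fin n))).filter (fun W => Disjoint W A),
              (prodBernoulli u).real {ω : BondConfig (Fin n) | ∀ z : Fin n, (z ∈ W ↔ ω ∈ ⋃ s ∈ S, openConn s z)}
                * (prodBernoulli u).real (openConnIn ((W : Set (Fin n))ᶜ) (sel W) b))) →
      (∀ sel : Finset (Fin n) → Fin n, (∀ W, sel W ∈ A) →
        ((prodBernoulli u).real (openConn a₀ b)
          + (prodBernoulli u).real ((openConn a₀ b)ᶜ ∩ (⋃ s ∈ ({y} : Finset (Fin n)), openConn a₀ s) ∩ (⋃ s ∈ ({y} : Finset (Fin n)), openConn s b))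
        ≤ (prodBernoulli u).real (⋃ s ∈ ({y} : Finset (Fin n)), openConn s b)
          + ∑ W ∈ (Finset.univ : Finset (Finset (Fin n))).filter (fun W => Disjoint W A),
              (prodBernoulli u).real {ω : BondConfig (Fin n) | ∀ z : Fin n, (z ∈ W ↔ ω ∈ ⋃ s ∈ ({y} : Finset (Fin n)), openConn s z)}
                * (prodBernoulli u).real (openConnIn ((W : Set (Fin n))ᶜ) (sel W) b))) →
      ∀ sel : Finset (Fin n) → Fin n, (∀ W, sel W ∈ A) →
        ((prodBernoulli u).real (openConn a₀ b)
          + (prodBernoulli u).real ((openConn a₀ b)ᶜ ∩ (⋃ s ∈ insert y S, openConn a₀ s) ∩ (⋃ s ∈ insert y S, openConn s b))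
        ≤ (prodBernoulli u).real (⋃ s ∈ insert y S, openConn s b)
          + ∑ W ∈ (Finset.univ : Finset (Finset (Fin n))).filter (fun W => Disjoint W A),
              (prodBernoulli u).real {ω : BondConfig (Fin n) | ∀ z : Fin n, (z ∈ W ↔ ω ∈ ⋃ s ∈ insert y S, openConn s z)}
                * (prodBernoulli u).real (openConnIn ((W : Set (Fin n))ᶜ) (sel W) b))) →
    Summit.CriticalPhenomena.PercolationContinuityZ3.Theses.PercNearOneGluing.AdditiveGluing := fun hM =>
  additiveGluing_of_residualKernelQ9 (residualKernelQ9_of_mergeStep hM)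

/-- **Merge step ⇒ `NoHeavyLowerTail`** (crux stmt-CriticalPhenomena-4575), through the landed chain
`AdditiveGluing ⇒ NearOneGluing ⇒ ManyFingersLargePocket ⇒ NoHeavyLowerTail`. [cite: KozmaNitzan2024, Conjecture 3 (p. 15)] -/
theorem noHeavyLowerTail_of_mergeStep :
    (∀ (n : ℕ) (u : Sym2 (Fin n) → unitInterval) (A S : Finset (Fin n)) (b a₀ y : Fin n),
      b ∈ A → Disjoint S A → y ∉ A → y ∉ S → S.Nonempty → 4 ≤ A.card → a₀ ∈ A →
      (∀ a ∈ A, (prodBernoulli u).real (openConn a₀ b) ≤ (prodBernoulli u).real (openConn a b)) →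
      (∀ v ∈ insert y S, (prodBernoulli u).real (openConn v b) < (prodBernoulli u).real (openConn a₀ b)) →
      (∀ s ∈ S, (prodBernoulli u).real (openConn y a₀) ≤ (prodBernoulli u).real (openConn s a₀)) →
      (∃ a ∈ A, (prodBernoulli (fun e : Sym2 (Fin n) => if (∀ x ∈ e, x ∈ insert y S) ∧ ¬ e.IsDiag then 1 else u e)).real (openConn a b) <
        (prodBernoulli (fun e : Sym2 (Fin n) => if (∀ x ∈ e, x ∈ insert y S) ∧ ¬ e.IsDiag then 1 else u e)).real (openConn a₀ b)) →
      (∀ w' : Sym2 (Fin n) → unitInterval,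
        (Finset.univ.filter (fun v : Fin n => ∃ z : Fin n, 0 < (w' s(z, v) : ℝ))).card ≤
          (Finset.univ.filter (fun v : Fin n => ∃ z : Fin n,
            0 < ((fun e : Sym2 (Fin n) => if (∀ x ∈ e, x ∈ insert y S) ∧ ¬ e.IsDiag then 1 else u e) s(z, v) : ℝ))).card →
        ∀ (A' : Finset (Fin n)) (o' b' : Fin n), b' ∈ A' → o' ∉ A' →
        ∀ c₀ : Fin n, c₀ ∈ A' →
          (∀ c ∈ A', (prodBernoulli (fun e : Sym2 (Fin n) => if o' ∈ e then (0 : unitInterval) else w' e)).real (openConn c₀ b') ≤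
            (prodBernoulli (fun e : Sym2 (Fin n) => if o' ∈ e then (0 : unitInterval) else w' e)).real (openConn c b')) →
          ∀ sel' : Finset (Fin n) → Fin n, (∀ W', sel' W' ∈ A') →
          (prodBernoulli w').real (openConn c₀ b') ≤
            (prodBernoulli w').real (openConn o' b')
              + ∑ W' ∈ (Finset.univ : Finset (Finset (Fin n))).filter (fun W' => o' ∈ W' ∧ Disjoint W' A'),
                  (prodBernoulli w').real {ω : BondConfig (Fin n) | openCluster ω o' = (W' : Set (Fin n))}
                    * (prodBernoulli w').real (openConnIn ((W' : Set (Fin n))ᶜ) (sel' W') b')) →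
      (∀ sel : Finset (Fin n) → Fin n, (∀ W, sel W ∈ A) →
        ((prodBernoulli u).real (openConn a₀ b)
          + (prodBernoulli u).real ((openConn a₀ b)ᶜ ∩ (⋃ s ∈ S, openConn a₀ s) ∩ (⋃ s ∈ S, openConn s b))
        ≤ (prodBernoulli u).real (⋃ s ∈ S, openConn s b)
          + ∑ W ∈ (Finset.univ : Finset (Finset (Fin n))).filter (fun W => Disjoint W A),
              (prodBernoulli u).real {ω : BondConfig (Fin n) | ∀ z : Fin n, (z ∈ W ↔ ω ∈ ⋃ s ∈ S, openConn s z)}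
                * (prodBernoulli u).real (openConnIn ((W : Set (Fin n))ᶜ) (sel W) b))) →
      (∀ sel : Finset (Fin n) → Fin n, (∀ W, sel W ∈ A) →
        ((prodBernoulli u).real (openConn a₀ b)
          + (prodBernoulli u).real ((openConn a₀ b)ᶜ ∩ (⋃ s ∈ ({y} : Finset (Fin n)), openConn a₀ s) ∩ (⋃ s ∈ ({y} : Finset (Fin n)), openConn s b))
        ≤ (prodBernoulli u).real (⋃ s ∈ ({y} : Finset (Fin n)), openConn s b)
          + ∑ W ∈ (Finset.univ : Finset (Finset (Fin n))).filter (fun W => Disjoint W A),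
              (prodBernoulli u).real {ω : BondConfig (Fin n) | ∀ z : Fin n, (z ∈ W ↔ ω ∈ ⋃ s ∈ ({y} : Finset (Fin n)), openConn s z)}
                * (prodBernoulli u).real (openConnIn ((W : Set (Fin n))ᶜ) (sel W) b))) →
      ∀ sel : Finset (Fin n) → Fin n, (∀ W, sel W ∈ A) →
        ((prodBernoulli u).real (openConn a₀ b)
          + (prodBernoulli u).real ((openConn a₀ b)ᶜ ∩ (⋃ s ∈ insert y S, openConn a₀ s) ∩ (⋃ s ∈ insert y S, openConn s b))
        ≤ (prodBernoulli u).real (⋃ s ∈ insert y S, openConn s b)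
          + ∑ W ∈ (Finset.univ : Finset (Finset (Fin n))).filter (fun W => Disjoint W A),
              (prodBernoulli u).real {ω : BondConfig (Fin n) | ∀ z : Fin n, (z ∈ W ↔ ω ∈ ⋃ s ∈ insert y S, openConn s z)}
                * (prodBernoulli u).real (openConnIn ((W : Set (Fin n))ᶜ) (sel W) b))) →
    Summit.CriticalPhenomena.PercolationContinuityZ3.Theses.PercNearOneGluing.NoHeavyLowerTail := fun hM =>
  noHeavyLowerTail_of_manyFingersLargePocket
    (manyFingersLargePocket_of_nearOneGluing (additiveGluingSuffices_proof (additiveGluing_of_mergeStep hM)))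

/-- Same, typed against the sibling route `PercNearOneGluingNoHeavy` (definitionally the shared decl). -/
theorem noHeavyLowerTail_noHeavy_of_mergeStep :
    (∀ (n : ℕ) (u : Sym2 (Fin n) → unitInterval) (A S : Finset (Fin n)) (b a₀ y : Fin n),
      b ∈ A → Disjoint S A → y ∉ A → y ∉ S → S.Nonempty → 4 ≤ A.card → a₀ ∈ A →
      (∀ a ∈ A, (prodBernoulli u).real (openConn a₀ b) ≤ (prodBernoulli u).real (openConn a b)) →
      (∀ v ∈ insert y S, (prodBernoulli u).real (openConn v b) < (prodBernoulli u).real (openConn a₀ b)) →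
      (∀ s ∈ S, (prodBernoulli u).real (openConn y a₀) ≤ (prodBernoulli u).real (openConn s a₀)) →
      (∃ a ∈ A, (prodBernoulli (fun e : Sym2 (Fin n) => if (∀ x ∈ e, x ∈ insert y S) ∧ ¬ e.IsDiag then 1 else u e)).real (openConn a b) <
        (prodBernoulli (fun e : Sym2 (Fin n) => if (∀ x ∈ e, x ∈ insert y S) ∧ ¬ e.IsDiag then 1 else u e)).real (openConn a₀ b)) →
      (∀ w' : Sym2 (Fin n) → unitInterval,
        (Finset.univ.filter (fun v : Fin n => ∃ z : Fin n, 0 < (w' s(z, v) : ℝ))).card ≤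
          (Finset.univ.filter (fun v : Fin n => ∃ z : Fin n,
            0 < ((fun e : Sym2 (Fin n) => if (∀ x ∈ e, x ∈ insert y S) ∧ ¬ e.IsDiag then 1 else u e) s(z, v) : ℝ))).card →
        ∀ (A' : Finset (Fin n)) (o' b' : Fin n), b' ∈ A' → o' ∉ A' →
        ∀ c₀ : Fin n, c₀ ∈ A' →
          (∀ c ∈ A', (prodBernoulli (fun e : Sym2 (Fin n) => if o' ∈ e then (0 : unitInterval) else w' e)).real (openConn c₀ b') ≤
            (prodBernoulli (fun e : Sym2 (Fin n) => if o' ∈ e then (0 : unitInterval) else w' e)).real (openConn c b')) →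
          ∀ sel' : Finset (Fin n) → Fin n, (∀ W', sel' W' ∈ A') →
          (prodBernoulli w').real (openConn c₀ b') ≤
            (prodBernoulli w').real (openConn o' b')
              + ∑ W' ∈ (Finset.univ : Finset (Finset (Fin n))).filter (fun W' => o' ∈ W' ∧ Disjoint W' A'),
                  (prodBernoulli w').real {ω : BondConfig (Fin n) | openCluster ω o' = (W' : Set (Fin n))}
                    * (prodBernoulli w').real (openConnIn ((W' : Set (Fin n))ᶜ) (sel' W') b')) →
      (∀ sel : Finset (Fin n) → Fin n, (∀ W, sel W ∈ A) →
        ((prodBernoulli u).real (openConn a₀ b)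
          + (prodBernoulli u).real ((openConn a₀ b)ᶜ ∩ (⋃ s ∈ S, openConn a₀ s) ∩ (⋃ s ∈ S, openConn s b))
        ≤ (prodBernoulli u).real (⋃ s ∈ S, openConn s b)
          + ∑ W ∈ (Finset.univ : Finset (Finset (Fin n))).filter (fun W => Disjoint W A),
              (prodBernoulli u).real {ω : BondConfig (Fin n) | ∀ z : Fin n, (z ∈ W ↔ ω ∈ ⋃ s ∈ S, openConn s z)}
                * (prodBernoulli u).real (openConnIn ((W : Set (Fin n))ᶜ) (sel W) b))) →
      (∀ sel : Finset (Fin n) → Fin n, (∀ W, sel W ∈ A) →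
        ((prodBernoulli u).real (openConn a₀ b)
          + (prodBernoulli u).real ((openConn a₀ b)ᶜ ∩ (⋃ s ∈ ({y} : Finset (Fin n)), openConn a₀ s) ∩ (⋃ s ∈ ({y} : Finset (Fin n)), openConn s b))
        ≤ (prodBernoulli u).real (⋃ s ∈ ({y} : Finset (Fin n)), openConn s b)
          + ∑ W ∈ (Finset.univ : Finset (Finset (Fin n))).filter (fun W => Disjoint W A),
              (prodBernoulli u).real {ω : BondConfig (Fin n) | ∀ z : Fin n, (z ∈ W ↔ ω ∈ ⋃ s ∈ ({y} : Finset (Fin n)), openConn s z)}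
                * (prodBernoulli u).real (openConnIn ((W : Set (Fin n))ᶜ) (sel W) b))) →
      ∀ sel : Finset (Fin n) → Fin n, (∀ W, sel W ∈ A) →
        ((prodBernoulli u).real (openConn a₀ b)
          + (prodBernoulli u).real ((openConn a₀ b)ᶜ ∩ (⋃ s ∈ insert y S, openConn a₀ s) ∩ (⋃ s ∈ insert y S, openConn s b))
        ≤ (prodBernoulli u).real (⋃ s ∈ insert y S, openConn s b)
          + ∑ W ∈ (Finset.univ : Finset (Finset (Fin n))).filter (fun W => Disjoint W A),
              (prodBernoulli u).real {ω : BondConfig (Fin n) | ∀ z : Fin n, (z ∈ W ↔ ω ∈ ⋃ s ∈ insert y S, openConn s z)}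
                * (prodBernoulli u).real (openConnIn ((W : Set (Fin n))ᶜ) (sel W) b))) →
    Summit.CriticalPhenomena.PercolationContinuityZ3.Theses.PercNearOneGluingNoHeavy.NoHeavyLowerTail := fun hM =>
  noHeavyLowerTail_of_mergeStep hM

end MergeStep

end

end Summit.CriticalPhenomena.PercolationContinuityZ3.Theorems
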